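import Summits.FinalStateConjecture.FinalStateConjecture.Theorems.BulkKerrCapture.Negative.SpinGapAndMass
import Summits.FinalStateConjecture.FinalStateConjecture.Theorems.NearExtremalKappaCapture.Negative.ExponentMonotonicity
import Summits.FinalStateConjecture.FinalStateConjecture.Theorems.PhaseMixingCaptureBulkKerrCaptureFaithfulOfClaim
import Literature.Geometry.Lorentzian.KerrStabilitySubextremalCauchy
import HarnessLib

/-!
# Line `two-centre-lebesgue-cover` for crux `BulkKerrCapture` (stmt-FinalStateConjecture-10696)
— skeleton v2.3 (line lead `prover-line-stmt-FinalStateConjecture-10696-0`, 2026-08-16)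

Route `PhaseMixingCapture`, rank-4 crux
`Summit.FinalStateConjecture.FinalStateConjecture.Theses.PhaseMixingCapture.BulkKerrCapture`
(sub-extremal Kerr stability in the bulk: at the horizon-penetrating Kerr–Schild leaf `r₀ = M`,
every vacuum datum in a finite-order `H^s_δ`-ball around `Kerr.data M a M` has all its MGHDs
far-complete, converging in `Cᵏ` to a sub-extremal Kerr, with modulus `C √dist`, the constants
`(ε, C)` UNIFORM on every compact spin set `|a| ≤ a₁ M`, `a₁ < 1`). Idea card
`Cruxes/BulkKerrCapture/Ideas/two-centre-lebesgue-cover.md`, planner's line card and skeleton v1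
`Lines/two-centre-lebesgue-cover.{md,lean}` (3 stubs: A `stub_twoCentreUnitMassCapture` (vendored,
unit mass, anchored far chart, modulus inside), F `stub_farChartNullCompleteness`, S
`stub_captureAt_scaling`).

## Why v2 (lead's reshape, L4; same composition idea — uniformity is a Lebesgue number)

Reading the source (Hintz arXiv:2606.28253v2, pp. 1–3, 318–323) against the tree showed that the
house conventions already decide the two "closable" stubs of v1, and that the tree already holds an
AUDIT of exactly this import (2026-08-15, `Literature/Barriers/FinalStateConjecture/
SlowlyRotatingKerrFrontierProofs.lean`, §"Review-split audit"): the crux-shaped uniform statement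
"exceeds Thm. 13.1 in three independent respects — (i) UNIFORMITY … (ii) DATA: an `H^s_δ`-ball of
one finite order `s` is not contained in the printed hypothesis (13.1a) … (iii) MODULUS: `≤ C √dist`,
whereas the print has '… with `|b − b₀|` and `|S|` small'". Consequently:

* S (scaling) is not a stub but a quantifier shape: the vendored fact is stated with the mass
  quantified INSIDE (`∀ χ₀ ∃ (s,δ,k,ς) ∀ M ∀ η ∃ ε ∀ a, |a/M − χ₀| < ς → …`), exactly as gr.S05-cauchy
  takes its threshold "uniform in `M` by scale invariance"; the finite-subcover lemma below then
  runs at every mass directly (no transport of `InitialDataSet`/MGHD/`ConvergesToKerr`/sojourns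
  under a homothety is needed — that transport was v1's stub S, XL in Lean and idle here).
* F (anchored far chart ⇒ sojourn-complete far `𝓘⁺`) is not a stub but the audit's paraphrase
  convention: the 2026-08-15 rendering of Thm. 13.1 (`SlowlyRotatingKerrFrontierNarrow.conormalData`)
  carries `HasCompleteFutureNullInfinityFar` "for the `O(r⁻¹)` control near `𝓘⁺`" (rate (4)), as
  gr.S05-cauchy does for Klainerman–Szeftel. (F remains a desirable Literature THEOREM — the
  geometric criterion is stated once and for all in v1 — and is the lead's FALLBACK should review
  reject clause (ε) of the fact; the geodesic layer it needs is discharged in the tree: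
  `existsUnique_isMaximalGeodesicOn_holds`, `isGeodesicOn_comp`, `exists_geodesic_lift`,
  `image_causalFuture_subset`, `isFutureCausalCurveOn_of_nullRay`.)
* A is split along the audit's fault lines into what is CLAIMED IN PRINT and what is not:
  - `stub_hintzClaim` — the Literature claim BY NAME,
    `Literature.Geometry.Lorentzian.hintz_kerr_stability_subextremal_cauchy` (filed by the lead and
    LANDED, p78222, commit 8b73bc249cf9, `@[claim "Hintz2026" "under-review"]`): Thm. 1.1/13.1 + Rem. 13.2/13.3 in
    the audit's conventions (b-conormal side condition `∀ s', dist_{s',δ} < ⊤`, `∀ η ∃ ε` nearness,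
    far-complete `𝓘⁺`, `ConvergesToKerr`; NO modulus) plus Rem. 13.2's local uniformity in the centre
    at fixed inner radius. Closes modulo that named fact (debt queue), never by a prover.
  - `stub_faithful_of_claim` — PROVABLE and the line's mathematics: the claim ⇒ the crux's
    FAITHFUL form (`a₁`-uniform on compact spin sets, conormal, qualitative) by the Lebesgue number
    of a finite subcover of `[−a₁, a₁] ⊂ (−1, 1)` at `ρ₀ = 1` (inner radius `= M`), `max s`,
    `max δ`, `min k`, `min ε` and the `(s, δ)`-monotonicity of the data distance.
  - `stub_qualitative_of_faithful` — gap (ii) of the audit (finite regularity, "G1" of all three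
    triagers): drop the b-conormal side condition. Unprinted; a statement about the finite-loss
    Nash–Moser scheme, not about the theorem. OPEN.
  - `stub_bulk_of_qualitative` — gap (iii) (the `C √dist` modulus, uniform `C` on compact spin
    sets): unprinted for `|a| ≫ 0` (Klainerman–Szeftel print it for `|a| ≪ M` only). OPEN; the levers
    of the sibling lines (`frozen-charge-flat-modulus`: NM output bound; `recoil-budget-modulus`:
    Bondi budgets) are exactly attempts at this one implication.
  Gap (i) of the audit (uniformity as `|a₀| → m₀`) is NOT needed by the crux (`a₁ < 1`; the
  Lebesgue step uses the strict gap exactly once) — the one respect in which the crux is weaker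
  than the audited `SlowlyRotatingKerrFrontierNarrow`.

PROVED here (no stub): `qualitative_of_bulk` (the crux implies its qualitative form: `C √dist ≤ η`
on a shrunk ball), `faithful_of_qualitative` (adding the conormal hypothesis weakens), hence
`faithful_of_bulk`; the composition `BulkKerrCapture_of` (closed term over the four stubs, concludes
the crux BY NAME).

DISPROOF USED (`Cruxes/BulkKerrCapture/Disproof.lean` v4, cycles 1–2, NO KILL; landed
`Negative/SpinGapAndMass.lean`, `Negative/PointwiseVsUniform.lean`, both imported/used):
`bulkCaptureFamily_false_without_spinGap` — `a₁ < 1` is used exactly once, in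
`stub_faithful_of_claim` (the segment `[−a₁, a₁]` must lie in the open interval of centres); no
stub asserts anything at `|χ₀| = 1` (cf. §3c `UniformToExtremalityCapture`). `_false_without_posMass`
— `0 < M` forms `a/M`. §5(c) `s ≥ 2` load-bearing / §3c `LowRegularityCapture` — every stub has `s`
existential after the centre. §5(d) `r₀ = M ≤ r₊` — kept (`ρ₀ = 1`). §5(e) the `H_b^∞`-vs-finite-`s`
vendoring gap — now ISOLATED as `stub_qualitative_of_faithful` instead of being buried in A. §4
"linear modulus unprinted" — the `√` modulus is itself unprinted for large spins: isolated as
`stub_bulk_of_qualitative`. `-- Targets`: none yet.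
-/

set_option linter.dupNamespace false

noncomputable section

open Set Filter Topology Function
open scoped Manifold ContDiff ENNReal Topology
open Literature.Geometry.Lorentzian
open Summit.FinalStateConjecture.FinalStateConjecture.Theorems.BulkKerrCapture
open Summit.FinalStateConjecture.FinalStateConjecture.Theses.PhaseMixingCapture (BulkKerrCapture)

namespace Summit.FinalStateConjecture.FinalStateConjecture.Cruxes.BulkKerrCapture.TwoCentreLebesgueCover

/-! ## §1 Registered stubs (the only `sorry`s: Stub 1 = the landed Literature claim by name; Stubs 3, 4 = the unprinted residue; Stub 2 is landed) -/

/-- **Stub 1 — the vendored claim, BY NAME** (the Literature named fact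
`Literature.Geometry.Lorentzian.hintz_kerr_stability_subextremal_cauchy`, LANDED p78222, commit
8b73bc249cf9, claim-tagged `Hintz2026`/under-review; closes only by a `_holds` discharge of that fact): for every normalised sub-extremal centre `χ₀` and normalised inner radius
`ρ₀` between the unit-mass horizons there are `(s, δ, k, ς)`; per mass `M > 0` and tolerance `η > 0`
one basin `ε`; for every spin `a` with `|a/M − χ₀| < ς` at `r₀ = ρ₀ M ∈ (r₋, r₊)`, every b-conormal
(`∀ s', dist_{s',δ} < ⊤`) vacuum datum `ε`-close at order `s` to `Kerr.data M a r₀` has all MGHDs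
with a sub-extremal `(M', a')`, `|M' − M| + |a' − a| ≤ η`, far-complete `𝓘⁺`, and `Cᵏ`-convergence to
`g_{M',a'}`. Hintz arXiv:2606.28253 Thm. 1.1 (p. 2) / Thm. 13.1 (pp. 318–319) / Rem. 13.2–13.3
(pp. 319–320) in the 2026-08-15 audit's consequence-form conventions. Closes only modulo the named
fact (an unrefereed claim); size XL as mathematics, 0 as Lean once the fact is citable.
[cite: Hintz2026, Thm. 13.1 (pp. 318–319) and Remark 13.2 (p. 319)] -/
theorem stub_hintzClaim :
    ∀ [Kerr.Facts] [Kerr.SliceFacts], hintz_kerr_stability_subextremal_cauchy := by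
  sorry

/-- **Stub 2 — the Lebesgue number (PROVED and LANDED, p77821; the line's lever).** The claim (Stub 1's body as a
hypothesis) implies the FAITHFUL form of the crux: for every `a₁ < 1` one `(s, δ, k)` and, per mass
and tolerance, one `ε` serve every spin `|a| ≤ a₁ M` at the leaf `r₀ = M` (b-conormal data,
qualitative nearness). Proof plan: `a₁ < 0` vacuous (`Negative.no_spin_of_neg`); else cover the
compact segment `K = [−a₁, a₁] ⊂ (−1, 1)` of normalised spins by the balls `(χ₀ − ς, χ₀ + ς)` of the
claim at `ρ₀ = 1` (`1 ∈ (1 − √(1 − χ₀²), 1 + √(1 − χ₀²))` since `|χ₀| < 1`), extract a finite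
subcover (`IsCompact.elim_finite_subcover_image`), take `max s`, `max δ`, `min k` over it
(independent of `M`, `η`) and, for each `(M, η)`, `min ε`; move each local body to the common
parameters with the `(s, δ)`-monotonicity of `dataWeightedSobolevEDist`
(`Theorems.NearExtremalKappaCapture.Negative.dataWeightedSobolevEDist_mono`: the conormal hypothesis
at the larger `δ` gives it at the smaller, the `ε`-ball at the larger `(s, δ)` lies in the smaller's)
and `Spacetime.ConvergesTo.of_le` for `k`; `r₀ = M = 1 · M ∈ (r₋, r₊)` by
`Negative.mem_Ioo_rMinus_rPlus`. Template: `captureAt_uniform_of_local` of the sibling skeleton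
`Lines/frozen-charge-flat-modulus.lean` (kernel-checked). [folklore] -/
theorem stub_faithful_of_claim :
    (∀ [Kerr.Facts] [Kerr.SliceFacts],
      ∀ χ₀ : ℝ, |χ₀| < 1 → ∀ ρ₀ ∈ Set.Ioo (1 - √(1 - χ₀ ^ 2)) (1 + √(1 - χ₀ ^ 2)),
        ∃ (s : ℕ) (δ : ℝ) (k : ℕ), ∃ ς > (0 : ℝ), ∀ (M : ℝ) (hM : 0 < M), ∀ η > (0 : ℝ),
          ∃ ε > (0 : ℝ), ∀ a r₀ : ℝ, |a / M - χ₀| < ς → r₀ = ρ₀ * M →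
            r₀ ∈ Set.Ioo (Kerr.rMinus M a) (Kerr.rPlus M a) →
            ∀ (D : InitialDataSet 𝓘(ℝ, E3) (Kerr.slice a r₀)) [D.metric.HasLeviCivita],
              D.IsVacuumConstraintSolution →
              (∀ s' : ℕ,
                InitialDataSet.dataWeightedSobolevEDist s' δ D (Kerr.data M a r₀ hM.le) < ⊤) →
              InitialDataSet.dataWeightedSobolevEDist s δ D (Kerr.data M a r₀ hM.le) <
                ENNReal.ofReal ε →
              ∀ 𝒟 : VacuumCauchyDevelopment D, 𝒟.IsMaximal →
                ∃ (M' a' : ℝ) (𝒟oc : Set 𝒟.carrier), Kerr.IsSubextremal M' a' ∧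
                  |M' - M| + |a' - a| ≤ η ∧
                  𝒟.HasCompleteFutureNullInfinityFar ∧
                  𝒟.toSpacetime.ConvergesToKerr 𝒟oc M' a' k) →
    ∀ [Kerr.Facts] [Kerr.SliceFacts], ∀ a₁ : ℝ, a₁ < 1 → ∃ (s : ℕ) (δ : ℝ) (k : ℕ),
      ∀ (M : ℝ) (hM : 0 < M), ∀ η > (0 : ℝ), ∃ ε > (0 : ℝ), ∀ a : ℝ, |a| ≤ a₁ * M →
        ∀ (D : InitialDataSet 𝓘(ℝ, E3) (Kerr.slice a M)) [D.metric.HasLeviCivita],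
          D.IsVacuumConstraintSolution →
          (∀ s' : ℕ,
            InitialDataSet.dataWeightedSobolevEDist s' δ D (Kerr.data M a M hM.le) < ⊤) →
          InitialDataSet.dataWeightedSobolevEDist s δ D (Kerr.data M a M hM.le) <
            ENNReal.ofReal ε →
          ∀ 𝒟 : VacuumCauchyDevelopment D, 𝒟.IsMaximal →
            ∃ (M' a' : ℝ) (𝒟oc : Set 𝒟.carrier), Kerr.IsSubextremal M' a' ∧
              |M' - M| + |a' - a| ≤ η ∧
              𝒟.HasCompleteFutureNullInfinityFar ∧
              𝒟.toSpacetime.ConvergesToKerr 𝒟oc M' a' k :=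
  -- LANDED: p77821 (commit 13fbef908065), `Theorems/PhaseMixingCaptureBulkKerrCaptureFaithfulOfClaim.lean`
  Summit.FinalStateConjecture.FinalStateConjecture.Theorems.stub_faithful_of_claim

/-- **Stub 3 — finite regularity (gap (ii) of the 2026-08-15 audit; "G1" of the triage; OPEN,
unprinted).** The faithful form (b-conormal data: `dist_{s',δ} < ⊤` at every order `s'`) implies the
qualitative form on the bare finite-order ball `dist_{s,δ} < ε`. Why plausible: a finite-loss
Nash–Moser scheme ([SR89] as used in Hintz §13.1 Step 3) consumes finitely many derivatives, so a
version of Thm. 13.1 with `H_b^{d'}` in place of `H_b^∞` in (13.1a) (and `Cᵏ` instead of `C^∞`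
conclusions) is expected; equivalently, b-conormal data are dense in the finite-order ball and the
conclusion is stable under `H^s_δ`-limits of data only if the constants are — which is the content.
Why it might fail: only as a statement about PROOFS (no counterexample is conceivable short of an
instability triggered by far-field oscillations of order `> s`, which carry vanishing energy). No
source prints it. [cite: Hintz2026, Remark 1.3 (p. 3) and Thm. 13.1 (13.1a) (p. 318)] -/
theorem stub_qualitative_of_faithful :
    (∀ [Kerr.Facts] [Kerr.SliceFacts], ∀ a₁ : ℝ, a₁ < 1 → ∃ (s : ℕ) (δ : ℝ) (k : ℕ),
      ∀ (M : ℝ) (hM : 0 < M), ∀ η > (0 : ℝ), ∃ ε > (0 : ℝ), ∀ a : ℝ, |a| ≤ a₁ * M →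
        ∀ (D : InitialDataSet 𝓘(ℝ, E3) (Kerr.slice a M)) [D.metric.HasLeviCivita],
          D.IsVacuumConstraintSolution →
          (∀ s' : ℕ,
            InitialDataSet.dataWeightedSobolevEDist s' δ D (Kerr.data M a M hM.le) < ⊤) →
          InitialDataSet.dataWeightedSobolevEDist s δ D (Kerr.data M a M hM.le) <
            ENNReal.ofReal ε →
          ∀ 𝒟 : VacuumCauchyDevelopment D, 𝒟.IsMaximal →
            ∃ (M' a' : ℝ) (𝒟oc : Set 𝒟.carrier), Kerr.IsSubextremal M' a' ∧
              |M' - M| + |a' - a| ≤ η ∧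
              𝒟.HasCompleteFutureNullInfinityFar ∧
              𝒟.toSpacetime.ConvergesToKerr 𝒟oc M' a' k) →
    ∀ [Kerr.Facts] [Kerr.SliceFacts], ∀ a₁ : ℝ, a₁ < 1 → ∃ (s : ℕ) (δ : ℝ) (k : ℕ),
      ∀ (M : ℝ) (hM : 0 < M), ∀ η > (0 : ℝ), ∃ ε > (0 : ℝ), ∀ a : ℝ, |a| ≤ a₁ * M →
        ∀ (D : InitialDataSet 𝓘(ℝ, E3) (Kerr.slice a M)) [D.metric.HasLeviCivita],
          D.IsVacuumConstraintSolution →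
          InitialDataSet.dataWeightedSobolevEDist s δ D (Kerr.data M a M hM.le) <
            ENNReal.ofReal ε →
          ∀ 𝒟 : VacuumCauchyDevelopment D, 𝒟.IsMaximal →
            ∃ (M' a' : ℝ) (𝒟oc : Set 𝒟.carrier), Kerr.IsSubextremal M' a' ∧
              |M' - M| + |a' - a| ≤ η ∧
              𝒟.HasCompleteFutureNullInfinityFar ∧
              𝒟.toSpacetime.ConvergesToKerr 𝒟oc M' a' k := by
  sorry

/-- **Stub 4 — the modulus (gap (iii) of the 2026-08-15 audit; OPEN, unprinted for large spins).**
The qualitative form of the crux (`∀ η ∃ ε`, finite-order ball, uniform on compact spin sets)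
implies the crux itself, stated through its matrix `Negative.CaptureAt` (`∃ ε, C` with
`|M' − M| + |a' − a| ≤ C √dist`, `C` uniform on `|a| ≤ a₁ M`; `Negative.bulkKerrCapture_iff`). For `|a| ≪ M` the `√`-modulus is printed (Klainerman–Szeftel, Main Theorem §3.4.3,
(3.4.7)–(3.4.8), vendored in `klainerman_szeftel_kerr_stability_small_a_cauchy`); for the full range
Hintz prints "`|b − b₀|` small" only. Mechanisms on offer (sibling lines of this crux): the
Nash–Moser output bound `|U|_{3d} ≲ ‖P(Ψ(0))‖_{2d'}` read off the proof of [SR89] (printed precedent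
for the same school: Hintz–Vasy arXiv:1606.04014, Thm. 13.1 "`|c| ≤ C‖d‖`, as follows from the
proof of Theorem 11.1 given in [SR89]") plus Lipschitz dependence of the Step-2 solutions on data —
a LINEAR modulus, `C · dist ≤ C · √dist` on balls of radius `≤ 1`; or Bondi-budget / area-law
arguments. Why it might fail: a sub-Hölder-½ response of the final mass along some family of data
at a large spin (none expected: charges are frozen on the ball and fluxes are quadratic). This stub
carries the ENTIRE unprinted quantitative content of the crux. [cite: KlainermanSzeftel2023, Main Theorem §3.4.3 (3.4.7)–(3.4.8)] -/
theorem stub_bulk_of_qualitative :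
    (∀ [Kerr.Facts] [Kerr.SliceFacts], ∀ a₁ : ℝ, a₁ < 1 → ∃ (s : ℕ) (δ : ℝ) (k : ℕ),
      ∀ (M : ℝ) (hM : 0 < M), ∀ η > (0 : ℝ), ∃ ε > (0 : ℝ), ∀ a : ℝ, |a| ≤ a₁ * M →
        ∀ (D : InitialDataSet 𝓘(ℝ, E3) (Kerr.slice a M)) [D.metric.HasLeviCivita],
          D.IsVacuumConstraintSolution →
          InitialDataSet.dataWeightedSobolevEDist s δ D (Kerr.data M a M hM.le) <
            ENNReal.ofReal ε →
          ∀ 𝒟 : VacuumCauchyDevelopment D, 𝒟.IsMaximal →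
            ∃ (M' a' : ℝ) (𝒟oc : Set 𝒟.carrier), Kerr.IsSubextremal M' a' ∧
              |M' - M| + |a' - a| ≤ η ∧
              𝒟.HasCompleteFutureNullInfinityFar ∧
              𝒟.toSpacetime.ConvergesToKerr 𝒟oc M' a' k) →
    ∀ [Kerr.Facts] [Kerr.SliceFacts], ∀ a₁ : ℝ, a₁ < 1 → ∃ (s : ℕ) (δ : ℝ) (k : ℕ),
      ∀ (M : ℝ) (hM : 0 < M), ∃ ε > (0 : ℝ), ∃ C : ℝ, ∀ a : ℝ, |a| ≤ a₁ * M →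
        Negative.CaptureAt s δ k M hM.le ε C a := by
  sorry

/-! ## §2 Proved: the crux implies its qualitative and its faithful forms -/

/-- **The crux implies its qualitative form**: shrink the basin to `min ε (η / max C 1)²`, so that
`C √dist ≤ η` (the `.nearness` trick of `klainerman_szeftel_kerr_stability_small_a_cauchy`).
Certifies that Stub 4 asks for a STRENGTHENING of a consequence of the crux, i.e. that the chain
claim ⇒ faithful ⇒ qualitative ⇒ crux loses nothing. [folklore] -/
theorem qualitative_of_bulk (h : BulkKerrCapture) :
    ∀ [Kerr.Facts] [Kerr.SliceFacts], ∀ a₁ : ℝ, a₁ < 1 → ∃ (s : ℕ) (δ : ℝ) (k : ℕ),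
      ∀ (M : ℝ) (hM : 0 < M), ∀ η > (0 : ℝ), ∃ ε > (0 : ℝ), ∀ a : ℝ, |a| ≤ a₁ * M →
        ∀ (D : InitialDataSet 𝓘(ℝ, E3) (Kerr.slice a M)) [D.metric.HasLeviCivita],
          D.IsVacuumConstraintSolution →
          InitialDataSet.dataWeightedSobolevEDist s δ D (Kerr.data M a M hM.le) <
            ENNReal.ofReal ε →
          ∀ 𝒟 : VacuumCauchyDevelopment D, 𝒟.IsMaximal →
            ∃ (M' a' : ℝ) (𝒟oc : Set 𝒟.carrier), Kerr.IsSubextremal M' a' ∧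
              |M' - M| + |a' - a| ≤ η ∧
              𝒟.HasCompleteFutureNullInfinityFar ∧
              𝒟.toSpacetime.ConvergesToKerr 𝒟oc M' a' k := by
  intro _ _ a₁ ha₁
  obtain ⟨s, δ, k, H⟩ := (Negative.bulkKerrCapture_iff.1 h) a₁ ha₁
  refine ⟨s, δ, k, fun M hM η hη ↦ ?_⟩
  obtain ⟨ε, hε, C, HC⟩ := H M hM
  have hC : 0 < max C 1 := lt_max_of_lt_right one_pos
  refine ⟨min ε ((η / max C 1) ^ 2), lt_min hε (pow_pos (div_pos hη hC) 2),
    fun a ha D _ hvac hdist 𝒟 hmax ↦ ?_⟩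
  have hdε : InitialDataSet.dataWeightedSobolevEDist s δ D (Kerr.data M a M hM.le) <
      ENNReal.ofReal ε :=
    hdist.trans_le (ENNReal.ofReal_le_ofReal (min_le_left _ _))
  obtain ⟨M', a', 𝒟oc, hsub, hfar, hconv, hpar⟩ := HC a ha D hvac hdε 𝒟 hmax
  refine ⟨M', a', 𝒟oc, hsub, hpar.trans ?_, hfar, hconv⟩
  set d := (InitialDataSet.dataWeightedSobolevEDist s δ D (Kerr.data M a M hM.le)).toReal
  have hd : d < (η / max C 1) ^ 2 :=
    (ENNReal.lt_ofReal_iff_toReal_lt hdist.ne_top).1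
      (hdist.trans_le (ENNReal.ofReal_le_ofReal (min_le_right _ _)))
  have hsd : √d < η / max C 1 := (Real.sqrt_lt' (div_pos hη hC)).2 hd
  calc C * √d ≤ max C 1 * √d := mul_le_mul_of_nonneg_right (le_max_left C 1) (Real.sqrt_nonneg _)
    _ ≤ max C 1 * (η / max C 1) := mul_le_mul_of_nonneg_left hsd.le hC.le
    _ = η := mul_div_cancel₀ η hC.ne'

/-- **The qualitative form implies the faithful form** (adding the b-conormality hypothesis
weakens the statement). Certifies that Stub 3 is a strengthening of a triviality's converse.
[folklore] -/
theorem faithful_of_qualitative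
    (h : ∀ [Kerr.Facts] [Kerr.SliceFacts], ∀ a₁ : ℝ, a₁ < 1 → ∃ (s : ℕ) (δ : ℝ) (k : ℕ),
      ∀ (M : ℝ) (hM : 0 < M), ∀ η > (0 : ℝ), ∃ ε > (0 : ℝ), ∀ a : ℝ, |a| ≤ a₁ * M →
        ∀ (D : InitialDataSet 𝓘(ℝ, E3) (Kerr.slice a M)) [D.metric.HasLeviCivita],
          D.IsVacuumConstraintSolution →
          InitialDataSet.dataWeightedSobolevEDist s δ D (Kerr.data M a M hM.le) <
            ENNReal.ofReal ε →
          ∀ 𝒟 : VacuumCauchyDevelopment D, 𝒟.IsMaximal →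
            ∃ (M' a' : ℝ) (𝒟oc : Set 𝒟.carrier), Kerr.IsSubextremal M' a' ∧
              |M' - M| + |a' - a| ≤ η ∧
              𝒟.HasCompleteFutureNullInfinityFar ∧
              𝒟.toSpacetime.ConvergesToKerr 𝒟oc M' a' k) :
    ∀ [Kerr.Facts] [Kerr.SliceFacts], ∀ a₁ : ℝ, a₁ < 1 → ∃ (s : ℕ) (δ : ℝ) (k : ℕ),
      ∀ (M : ℝ) (hM : 0 < M), ∀ η > (0 : ℝ), ∃ ε > (0 : ℝ), ∀ a : ℝ, |a| ≤ a₁ * M →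
        ∀ (D : InitialDataSet 𝓘(ℝ, E3) (Kerr.slice a M)) [D.metric.HasLeviCivita],
          D.IsVacuumConstraintSolution →
          (∀ s' : ℕ,
            InitialDataSet.dataWeightedSobolevEDist s' δ D (Kerr.data M a M hM.le) < ⊤) →
          InitialDataSet.dataWeightedSobolevEDist s δ D (Kerr.data M a M hM.le) <
            ENNReal.ofReal ε →
          ∀ 𝒟 : VacuumCauchyDevelopment D, 𝒟.IsMaximal →
            ∃ (M' a' : ℝ) (𝒟oc : Set 𝒟.carrier), Kerr.IsSubextremal M' a' ∧
              |M' - M| + |a' - a| ≤ η ∧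
              𝒟.HasCompleteFutureNullInfinityFar ∧
              𝒟.toSpacetime.ConvergesToKerr 𝒟oc M' a' k := by
  intro _ _ a₁ ha₁
  obtain ⟨s, δ, k, H⟩ := h a₁ ha₁
  refine ⟨s, δ, k, fun M hM η hη ↦ ?_⟩
  obtain ⟨ε, hε, Hε⟩ := H M hM η hη
  exact ⟨ε, hε, fun a ha D _ hvac _ hdist 𝒟 hmax ↦ Hε a ha D hvac hdist 𝒟 hmax⟩

/-- **The crux implies its faithful form** (`qualitative_of_bulk` then `faithful_of_qualitative`):
what the lead recommends as the import-grade restatement of rank 4 is a CONSEQUENCE of the item as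
filed, and — by Stubs 1–2 — a consequence of the printed claim. [folklore] -/
theorem faithful_of_bulk (h : BulkKerrCapture) :
    ∀ [Kerr.Facts] [Kerr.SliceFacts], ∀ a₁ : ℝ, a₁ < 1 → ∃ (s : ℕ) (δ : ℝ) (k : ℕ),
      ∀ (M : ℝ) (hM : 0 < M), ∀ η > (0 : ℝ), ∃ ε > (0 : ℝ), ∀ a : ℝ, |a| ≤ a₁ * M →
        ∀ (D : InitialDataSet 𝓘(ℝ, E3) (Kerr.slice a M)) [D.metric.HasLeviCivita],
          D.IsVacuumConstraintSolution →
          (∀ s' : ℕ,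
            InitialDataSet.dataWeightedSobolevEDist s' δ D (Kerr.data M a M hM.le) < ⊤) →
          InitialDataSet.dataWeightedSobolevEDist s δ D (Kerr.data M a M hM.le) <
            ENNReal.ofReal ε →
          ∀ 𝒟 : VacuumCauchyDevelopment D, 𝒟.IsMaximal →
            ∃ (M' a' : ℝ) (𝒟oc : Set 𝒟.carrier), Kerr.IsSubextremal M' a' ∧
              |M' - M| + |a' - a| ≤ η ∧
              𝒟.HasCompleteFutureNullInfinityFar ∧
              𝒟.toSpacetime.ConvergesToKerr 𝒟oc M' a' k :=
  faithful_of_qualitative (qualitative_of_bulk h)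

/-! ## §3 The composition -/

/-- **Composition (closed term over the four registered stubs; concludes the crux BY NAME).**
claim (Stub 1) ⇒ faithful uniform capture (Stub 2, the Lebesgue number — provable) ⇒ qualitative
capture on the finite-order ball (Stub 3, audit gap (ii)) ⇒ the crux with its `√`-modulus (Stub 4,
audit gap (iii)). [folklore] -/
theorem BulkKerrCapture_of : BulkKerrCapture :=
  Negative.bulkKerrCapture_iff.2
    (stub_bulk_of_qualitative (stub_qualitative_of_faithful (stub_faithful_of_claim stub_hintzClaim)))


/-! ## §4 For the planner: the proposed import-grade restatement of rank 4, kernel-checked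

`BulkKerrCaptureFaithful` below is the route decl `BulkKerrCapture` with exactly two edits — (a) the
b-conormality side condition `(∀ s', dist_{s',δ}(D, Kerr.data M a M) < ⊤) →` inserted after
`D.IsVacuumConstraintSolution →` (Hintz (13.1a) at `E₀ = ∅`; audit gap (ii)); (b) `∃ ε > 0, ∃ C, ∀ a`
replaced by `∀ η > 0, ∃ ε > 0, ∀ a` and the modulus `≤ C * √(dist).toReal` by `≤ η` ("`b` close to
`b₀`"; audit gap (iii)) — everything else verbatim (sojourn clause inlined, fully qualified names), so
it can be pasted into a `route edit`. `bulkKerrCaptureFaithful_iff` certifies it is the FAITHFUL form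
used by the stubs (the inlined sojourn clause is `HasCompleteFutureNullInfinityFar`, as in
`Negative.bulkKerrCapture_iff`); `bulkKerrCaptureFaithful_of_bulk` that it is implied by the item as
filed; `bulkKerrCaptureFaithful_of_claim` that it follows from the registered Stubs 1–2 alone, i.e.
closes modulo the claim-tagged Literature fact once Stub 2 has landed (p77821). -/

/-- **Proposed restatement of rank 4 (`BulkKerrCapture`) in import grade** — the route decl with the
b-conormality side condition added and the `C √dist` modulus replaced by qualitative nearness
`∀ η, ∃ ε, … |M' − M| + |a' − a| ≤ η`; verbatim otherwise. A named statement for the planner, not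
asserted. [cite: Hintz2026, Thm. 13.1 (pp. 318–319) and Remark 13.2 (p. 319)] -/
def BulkKerrCaptureFaithful : Prop :=
  ∀ [Literature.Geometry.Lorentzian.Kerr.Facts] [Literature.Geometry.Lorentzian.Kerr.SliceFacts], ∀ a₁ : ℝ, a₁ < 1 → ∃ (s : ℕ) (δ : ℝ) (k : ℕ), ∀ (M : ℝ) (hM : 0 < M), ∀ η > (0 : ℝ), ∃ ε > (0 : ℝ), ∀ a : ℝ, |a| ≤ a₁ * M → ∀ (D : Literature.Geometry.Lorentzian.InitialDataSet 𝓘(ℝ, Literature.Geometry.Lorentzian.E3) (Literature.Geometry.Lorentzian.Kerr.slice a M)) [D.metric.HasLeviCivita], D.IsVacuumConstraintSolution → (∀ s' : ℕ, Literature.Geometry.Lorentzian.InitialDataSet.dataWeightedSobolevEDist s' δ D (Literature.Geometry.Lorentzian.Kerr.data M a M hM.le) < ⊤) → Literature.Geometry.Lorentzian.InitialDataSet.dataWeightedSobolevEDist s δ D (Literature.Geometry.Lorentzian.Kerr.data M a M hM.le) < ENNReal.ofReal ε → ∀ 𝒟 : Literature.Geometry.Lorentzian.VacuumCauchyDevelopment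 D, 𝒟.IsMaximal → ∃ (M' a' : ℝ) (𝒟oc : Set 𝒟.carrier), Literature.Geometry.Lorentzian.Kerr.IsSubextremal M' a' ∧ (∀ [𝒟.metric.HasLeviCivita], ∃ B₀ : Set (Literature.Geometry.Lorentzian.Kerr.slice a M), IsCompact B₀ ∧ ∀ σ : ℝ, 0 < σ → ∃ B₁ : Set (Literature.Geometry.Lorentzian.Kerr.slice a M), IsCompact B₁ ∧ ∀ q ∈ {q : Literature.Geometry.Lorentzian.Kerr.slice a M | Literature.Geometry.Lorentzian.Kerr.afRadius a M + 1 ≤ ‖(q : Literature.Geometry.Lorentzian.E3)‖}, q ∉ B₁ → ∀ (ray : ℝ → 𝒟.carrier) (dom : Set ℝ), 𝒟.metric.IsNormalisedNullRayFrom 𝒟.timeOrientation 𝒟.embed 𝒟.normal q ray dom → ¬ BddAbove dom ∨ ENNReal.ofReal σ ≤ Literature.Geometry.Lorentzian.sojournTime ray dom (𝒟.metric.causalFuture 𝒟.timeOrientation (𝒟.embed '' B₀))) ∧ 𝒟.toSpacetime.ConvergesToKerr 𝒟oc M' a' k ∧ |M' - M| + |a' - a| ≤ η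

/-- The proposed restatement IS the faithful form of the stubs (unfold the inlined far-sojourn clause
to `DataEmbedding.HasCompleteFutureNullInfinityFar` via `Negative.range_farSliceIncl`, and permute the
conjuncts). [folklore] -/
theorem bulkKerrCaptureFaithful_iff :
    BulkKerrCaptureFaithful ↔
    ∀ [Kerr.Facts] [Kerr.SliceFacts], ∀ a₁ : ℝ, a₁ < 1 → ∃ (s : ℕ) (δ : ℝ) (k : ℕ),
      ∀ (M : ℝ) (hM : 0 < M), ∀ η > (0 : ℝ), ∃ ε > (0 : ℝ), ∀ a : ℝ, |a| ≤ a₁ * M →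
        ∀ (D : InitialDataSet 𝓘(ℝ, E3) (Kerr.slice a M)) [D.metric.HasLeviCivita],
          D.IsVacuumConstraintSolution →
          (∀ s' : ℕ,
            InitialDataSet.dataWeightedSobolevEDist s' δ D (Kerr.data M a M hM.le) < ⊤) →
          InitialDataSet.dataWeightedSobolevEDist s δ D (Kerr.data M a M hM.le) <
            ENNReal.ofReal ε →
          ∀ 𝒟 : VacuumCauchyDevelopment D, 𝒟.IsMaximal →
            ∃ (M' a' : ℝ) (𝒟oc : Set 𝒟.carrier), Kerr.IsSubextremal M' a' ∧
              |M' - M| + |a' - a| ≤ η ∧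
              𝒟.HasCompleteFutureNullInfinityFar ∧
              𝒟.toSpacetime.ConvergesToKerr 𝒟oc M' a' k := by
  simp only [BulkKerrCaptureFaithful, DataEmbedding.HasCompleteFutureNullInfinityFar,
    DataEmbedding.HasCompleteFutureNullInfinityFrom, Negative.range_farSliceIncl]
  -- descend through the common quantifier prefix, then permute the conjuncts
  refine forall_congr' fun _ ↦ forall_congr' fun _ ↦ forall_congr' fun a₁ ↦
    forall_congr' fun _ ↦ ?_
  refine exists_congr fun s ↦ exists_congr fun δ ↦ exists_congr fun k ↦ ?_
  refine forall_congr' fun M ↦ forall_congr' fun hM ↦ forall_congr' fun η ↦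
    forall_congr' fun _ ↦ ?_
  refine exists_congr fun ε ↦ and_congr_right fun _ ↦ ?_
  refine forall_congr' fun a ↦ forall_congr' fun _ ↦ forall_congr' fun D ↦
    forall_congr' fun _ ↦ forall_congr' fun _ ↦ forall_congr' fun _ ↦ forall_congr' fun _ ↦ ?_
  refine forall_congr' fun 𝒟 ↦ forall_congr' fun _ ↦ ?_
  refine exists_congr fun M' ↦ exists_congr fun a' ↦ exists_congr fun 𝒟oc ↦ ?_
  exact ⟨fun ⟨h₁, h₂, h₃, h₄⟩ ↦ ⟨h₁, h₄, h₂, h₃⟩, fun ⟨h₁, h₂, h₃, h₄⟩ ↦ ⟨h₁, h₃, h₄, h₂⟩⟩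

/-- The proposed restatement is implied by the item as filed. [folklore] -/
theorem bulkKerrCaptureFaithful_of_bulk (h : BulkKerrCapture) : BulkKerrCaptureFaithful :=
  bulkKerrCaptureFaithful_iff.2 (faithful_of_bulk h)

/-- The proposed restatement follows from Stubs 1–2 alone (claim + Lebesgue number): it closes modulo
the claim-tagged fact `hintz_kerr_stability_subextremal_cauchy`. [folklore] -/
theorem bulkKerrCaptureFaithful_of_claim : BulkKerrCaptureFaithful :=
  bulkKerrCaptureFaithful_iff.2 (stub_faithful_of_claim stub_hintzClaim)

end Summit.FinalStateConjecture.FinalStateConjecture.Cruxes.BulkKerrCapture.TwoCentreLebesgueCover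

end
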